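import Summits.MatrixMultiplication.OmegaCensus.DominoZ13Z13Cells
import Summits.MatrixMultiplication.OmegaCensus.DominoZ13Z13StructSevenCells
import Summits.MatrixMultiplication.OmegaCensus.ThreeSetZ4Z4Cells
import Summits.MatrixMultiplication.OmegaCensus.DihedralLawModOneOrder25
import HarnessLib

/-!
# The `|A| ≡ 1 (mod 3)` law at `|A| = 169`: no law over `ℤ_13 × ℤ_13` (order `169` as one kernel theorem)

ω-census `pub-omega`, family (b3), seat pub-omega-group gen 38.  Framing: lottery ticket; floor = certified bounds/negative ranges.
VALUE: ONE kernel theorem for the census line `|A| = 169` of the classification of dihedral-like groups attaining the law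
`3|S||T||U| + 8 = 8|A|` ('law ⟹ an element of order `≥ |A|/2`'; `ℤ_13²` is the only non-cyclic abelian group of order `169`) — assembled
from existing kernel cells, no new computation; NOT progress on ω.

Proof of **`no_mod_one_law_z13_z13`** (same assembly as `DihedralLawModOneOrder325.no_mod_one_law_z5_z65`).  Every element of `ℤ_13²` has order
`≤ 13 < |A|/2`, so `A` is not two cosets of a cyclic subgroup (`two_cosets_of_mod_one_law_of_not_cube`: the parts are cube,
`(s,s | t,t | u,u)` with `3stu + 1 = 169`, `stu = 56` — `cube_factor_of_169`, `30` ordered factorisations); two parts `1`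
(`card_le_two_mul_addOrderOf_of_two_two_law`) or a part `2` (`card_le_two_mul_addOrderOf_of_mod_one_law_card_four`) again give an element of
order `≥ |A|/2`; the remaining shapes are the census cells `(1,4,14)` (`no_law_cube_14e_of_onto_z13z13`), `(1,7,8)` (`no_law_cube_17e_of_onto_z13z13`) in all orderings
(`no_law_cube_two_parts_of_ordered`).
-/

namespace Summit.MatrixMultiplication.OmegaCensus

open Literature.Combinatorics.Additive Finset

/-! ## Arithmetic: the ordered factorisations of `56` -/

section Arith

/-- The cube part sizes at `|A| = 169`: `cde = 56`, all `30` ordered factorisations. [folklore] -/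
theorem cube_factor_of_169 {c d e : ℕ} (h : 3 * (c * d * e) + 1 = 169) :
    (c = 1 ∧ d = 1 ∧ e = 56) ∨
      (c = 1 ∧ d = 2 ∧ e = 28) ∨
      (c = 1 ∧ d = 4 ∧ e = 14) ∨
      (c = 1 ∧ d = 7 ∧ e = 8) ∨
      (c = 1 ∧ d = 8 ∧ e = 7) ∨
      (c = 1 ∧ d = 14 ∧ e = 4) ∨
      (c = 1 ∧ d = 28 ∧ e = 2) ∨
      (c = 1 ∧ d = 56 ∧ e = 1) ∨
      (c = 2 ∧ d = 1 ∧ e = 28) ∨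
      (c = 2 ∧ d = 2 ∧ e = 14) ∨
      (c = 2 ∧ d = 4 ∧ e = 7) ∨
      (c = 2 ∧ d = 7 ∧ e = 4) ∨
      (c = 2 ∧ d = 14 ∧ e = 2) ∨
      (c = 2 ∧ d = 28 ∧ e = 1) ∨
      (c = 4 ∧ d = 1 ∧ e = 14) ∨
      (c = 4 ∧ d = 2 ∧ e = 7) ∨
      (c = 4 ∧ d = 7 ∧ e = 2) ∨
      (c = 4 ∧ d = 14 ∧ e = 1) ∨
      (c = 7 ∧ d = 1 ∧ e = 8) ∨
      (c = 7 ∧ d = 2 ∧ e = 4) ∨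
      (c = 7 ∧ d = 4 ∧ e = 2) ∨
      (c = 7 ∧ d = 8 ∧ e = 1) ∨
      (c = 8 ∧ d = 1 ∧ e = 7) ∨
      (c = 8 ∧ d = 7 ∧ e = 1) ∨
      (c = 14 ∧ d = 1 ∧ e = 4) ∨
      (c = 14 ∧ d = 2 ∧ e = 2) ∨
      (c = 14 ∧ d = 4 ∧ e = 1) ∨
      (c = 28 ∧ d = 1 ∧ e = 2) ∨
      (c = 28 ∧ d = 2 ∧ e = 1) ∨
      (c = 56 ∧ d = 1 ∧ e = 1) := by
  have hcde : c * (d * e) = 56 := by rw [← mul_assoc]; omega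
  have hc : c ∈ Nat.divisors 56 := Nat.mem_divisors.2 ⟨Dvd.intro _ hcde, by norm_num⟩
  have hd : d ∈ Nat.divisors 56 :=
    Nat.mem_divisors.2 ⟨Dvd.intro (c * e) (by rw [← hcde]; ring), by norm_num⟩
  rw [show Nat.divisors 56 = {1, 2, 4, 7, 8, 14, 28, 56} from by decide] at hc hd
  simp only [Finset.mem_insert, Finset.mem_singleton] at hc hd
  rcases hc with rfl | rfl | rfl | rfl | rfl | rfl | rfl | rfl <;> rcases hd with rfl | rfl | rfl | rfl | rfl | rfl | rfl | rfl
  · have he : e = 56 := by omega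
    exact Or.inl ⟨rfl, rfl, he⟩
  · have he : e = 28 := by omega
    exact Or.inr (Or.inl ⟨rfl, rfl, he⟩)
  · have he : e = 14 := by omega
    exact Or.inr (Or.inr (Or.inl ⟨rfl, rfl, he⟩))
  · have he : e = 8 := by omega
    exact Or.inr (Or.inr (Or.inr (Or.inl ⟨rfl, rfl, he⟩)))
  · have he : e = 7 := by omega
    exact Or.inr (Or.inr (Or.inr (Or.inr (Or.inl ⟨rfl, rfl, he⟩))))
  · have he : e = 4 := by omega
    exact Or.inr (Or.inr (Or.inr (Or.inr (Or.inr (Or.inl ⟨rfl, rfl, he⟩)))))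
  · have he : e = 2 := by omega
    exact Or.inr (Or.inr (Or.inr (Or.inr (Or.inr (Or.inr (Or.inl ⟨rfl, rfl, he⟩))))))
  · have he : e = 1 := by omega
    exact Or.inr (Or.inr (Or.inr (Or.inr (Or.inr (Or.inr (Or.inr (Or.inl ⟨rfl, rfl, he⟩)))))))
  · have he : e = 28 := by omega
    exact Or.inr (Or.inr (Or.inr (Or.inr (Or.inr (Or.inr (Or.inr (Or.inr (Or.inl ⟨rfl, rfl, he⟩))))))))
  · have he : e = 14 := by omega
    exact Or.inr (Or.inr (Or.inr (Or.inr (Or.inr (Or.inr (Or.inr (Or.inr (Or.inr (Or.inl ⟨rfl, rfl, he⟩)))))))))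
  · have he : e = 7 := by omega
    exact Or.inr (Or.inr (Or.inr (Or.inr (Or.inr (Or.inr (Or.inr (Or.inr (Or.inr (Or.inr (Or.inl ⟨rfl, rfl, he⟩))))))))))
  · have he : e = 4 := by omega
    exact Or.inr (Or.inr (Or.inr (Or.inr (Or.inr (Or.inr (Or.inr (Or.inr (Or.inr (Or.inr (Or.inr (Or.inl ⟨rfl, rfl, he⟩)))))))))))
  · omega
  · have he : e = 2 := by omega
    exact Or.inr (Or.inr (Or.inr (Or.inr (Or.inr (Or.inr (Or.inr (Or.inr (Or.inr (Or.inr (Or.inr (Or.inr (Or.inl ⟨rfl, rfl, he⟩))))))))))))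
  · have he : e = 1 := by omega
    exact Or.inr (Or.inr (Or.inr (Or.inr (Or.inr (Or.inr (Or.inr (Or.inr (Or.inr (Or.inr (Or.inr (Or.inr (Or.inr (Or.inl ⟨rfl, rfl, he⟩)))))))))))))
  · omega
  · have he : e = 14 := by omega
    exact Or.inr (Or.inr (Or.inr (Or.inr (Or.inr (Or.inr (Or.inr (Or.inr (Or.inr (Or.inr (Or.inr (Or.inr (Or.inr (Or.inr (Or.inl ⟨rfl, rfl, he⟩))))))))))))))
  · have he : e = 7 := by omega
    exact Or.inr (Or.inr (Or.inr (Or.inr (Or.inr (Or.inr (Or.inr (Or.inr (Or.inr (Or.inr (Or.inr (Or.inr (Or.inr (Or.inr (Or.inr (Or.inl ⟨rfl, rfl, he⟩)))))))))))))))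
  · omega
  · have he : e = 2 := by omega
    exact Or.inr (Or.inr (Or.inr (Or.inr (Or.inr (Or.inr (Or.inr (Or.inr (Or.inr (Or.inr (Or.inr (Or.inr (Or.inr (Or.inr (Or.inr (Or.inr (Or.inl ⟨rfl, rfl, he⟩))))))))))))))))
  · omega
  · have he : e = 1 := by omega
    exact Or.inr (Or.inr (Or.inr (Or.inr (Or.inr (Or.inr (Or.inr (Or.inr (Or.inr (Or.inr (Or.inr (Or.inr (Or.inr (Or.inr (Or.inr (Or.inr (Or.inr (Or.inl ⟨rfl, rfl, he⟩)))))))))))))))))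
  · omega
  · omega
  · have he : e = 8 := by omega
    exact Or.inr (Or.inr (Or.inr (Or.inr (Or.inr (Or.inr (Or.inr (Or.inr (Or.inr (Or.inr (Or.inr (Or.inr (Or.inr (Or.inr (Or.inr (Or.inr (Or.inr (Or.inr (Or.inl ⟨rfl, rfl, he⟩))))))))))))))))))
  · have he : e = 4 := by omega
    exact Or.inr (Or.inr (Or.inr (Or.inr (Or.inr (Or.inr (Or.inr (Or.inr (Or.inr (Or.inr (Or.inr (Or.inr (Or.inr (Or.inr (Or.inr (Or.inr (Or.inr (Or.inr (Or.inr (Or.inl ⟨rfl, rfl, he⟩)))))))))))))))))))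
  · have he : e = 2 := by omega
    exact Or.inr (Or.inr (Or.inr (Or.inr (Or.inr (Or.inr (Or.inr (Or.inr (Or.inr (Or.inr (Or.inr (Or.inr (Or.inr (Or.inr (Or.inr (Or.inr (Or.inr (Or.inr (Or.inr (Or.inr (Or.inl ⟨rfl, rfl, he⟩))))))))))))))))))))
  · omega
  · have he : e = 1 := by omega
    exact Or.inr (Or.inr (Or.inr (Or.inr (Or.inr (Or.inr (Or.inr (Or.inr (Or.inr (Or.inr (Or.inr (Or.inr (Or.inr (Or.inr (Or.inr (Or.inr (Or.inr (Or.inr (Or.inr (Or.inr (Or.inr (Or.inl ⟨rfl, rfl, he⟩)))))))))))))))))))))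
  · omega
  · omega
  · omega
  · have he : e = 7 := by omega
    exact Or.inr (Or.inr (Or.inr (Or.inr (Or.inr (Or.inr (Or.inr (Or.inr (Or.inr (Or.inr (Or.inr (Or.inr (Or.inr (Or.inr (Or.inr (Or.inr (Or.inr (Or.inr (Or.inr (Or.inr (Or.inr (Or.inr (Or.inl ⟨rfl, rfl, he⟩))))))))))))))))))))))
  · omega
  · omega
  · have he : e = 1 := by omega
    exact Or.inr (Or.inr (Or.inr (Or.inr (Or.inr (Or.inr (Or.inr (Or.inr (Or.inr (Or.inr (Or.inr (Or.inr (Or.inr (Or.inr (Or.inr (Or.inr (Or.inr (Or.inr (Or.inr (Or.inr (Or.inr (Or.inr (Or.inr (Or.inl ⟨rfl, rfl, he⟩)))))))))))))))))))))))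
  · omega
  · omega
  · omega
  · omega
  · have he : e = 4 := by omega
    exact Or.inr (Or.inr (Or.inr (Or.inr (Or.inr (Or.inr (Or.inr (Or.inr (Or.inr (Or.inr (Or.inr (Or.inr (Or.inr (Or.inr (Or.inr (Or.inr (Or.inr (Or.inr (Or.inr (Or.inr (Or.inr (Or.inr (Or.inr (Or.inr (Or.inl ⟨rfl, rfl, he⟩))))))))))))))))))))))))
  · have he : e = 2 := by omega
    exact Or.inr (Or.inr (Or.inr (Or.inr (Or.inr (Or.inr (Or.inr (Or.inr (Or.inr (Or.inr (Or.inr (Or.inr (Or.inr (Or.inr (Or.inr (Or.inr (Or.inr (Or.inr (Or.inr (Or.inr (Or.inr (Or.inr (Or.inr (Or.inr (Or.inr (Or.inl ⟨rfl, rfl, he⟩)))))))))))))))))))))))))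
  · have he : e = 1 := by omega
    exact Or.inr (Or.inr (Or.inr (Or.inr (Or.inr (Or.inr (Or.inr (Or.inr (Or.inr (Or.inr (Or.inr (Or.inr (Or.inr (Or.inr (Or.inr (Or.inr (Or.inr (Or.inr (Or.inr (Or.inr (Or.inr (Or.inr (Or.inr (Or.inr (Or.inr (Or.inr (Or.inl ⟨rfl, rfl, he⟩))))))))))))))))))))))))))
  · omega
  · omega
  · omega
  · omega
  · omega
  · have he : e = 2 := by omega
    exact Or.inr (Or.inr (Or.inr (Or.inr (Or.inr (Or.inr (Or.inr (Or.inr (Or.inr (Or.inr (Or.inr (Or.inr (Or.inr (Or.inr (Or.inr (Or.inr (Or.inr (Or.inr (Or.inr (Or.inr (Or.inr (Or.inr (Or.inr (Or.inr (Or.inr (Or.inr (Or.inr (Or.inl ⟨rfl, rfl, he⟩)))))))))))))))))))))))))))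
  · have he : e = 1 := by omega
    exact Or.inr (Or.inr (Or.inr (Or.inr (Or.inr (Or.inr (Or.inr (Or.inr (Or.inr (Or.inr (Or.inr (Or.inr (Or.inr (Or.inr (Or.inr (Or.inr (Or.inr (Or.inr (Or.inr (Or.inr (Or.inr (Or.inr (Or.inr (Or.inr (Or.inr (Or.inr (Or.inr (Or.inr (Or.inl ⟨rfl, rfl, he⟩))))))))))))))))))))))))))))
  · omega
  · omega
  · omega
  · omega
  · omega
  · omega
  · have he : e = 1 := by omega
    exact Or.inr (Or.inr (Or.inr (Or.inr (Or.inr (Or.inr (Or.inr (Or.inr (Or.inr (Or.inr (Or.inr (Or.inr (Or.inr (Or.inr (Or.inr (Or.inr (Or.inr (Or.inr (Or.inr (Or.inr (Or.inr (Or.inr (Or.inr (Or.inr (Or.inr (Or.inr (Or.inr (Or.inr (Or.inr (⟨rfl, rfl, he⟩)))))))))))))))))))))))))))))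
  · omega
  · omega
  · omega
  · omega
  · omega
  · omega
  · omega

end Arith

/-! ## Assembly -/

section DihedralLike

variable {G : Type} [Group G] [DecidableEq G] {S T U : Finset G}

/-- **ORDER 169: no dihedral-like group over `ℤ_13 × ℤ_13` (any presentation constant `c₀`; for `c₀ = 0` this is `Dih(ℤ_13²)`) has a TPP
triple attaining the law `3|S||T||U| + 8 = 8|A|`.** [folklore] -/
theorem no_mod_one_law_z13_z13 {ρ τ : ZMod 13 × ZMod 13 → G} {c₀ : ZMod 13 × ZMod 13}
    (hρρ : ∀ a b, ρ a * ρ b = ρ (a + b)) (hρτ : ∀ a b, ρ a * τ b = τ (b - a))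
    (hτρ : ∀ a b, τ a * ρ b = τ (a + b)) (hττ : ∀ a b, τ a * τ b = ρ (c₀ + b - a))
    (hρ : Function.Injective ρ) (hτ : Function.Injective τ) (hne : ∀ a b, ρ a ≠ τ b)
    (hsurj : ∀ g, (∃ a, ρ a = g) ∨ (∃ a, τ a = g)) (h : TripleProductProperty S T U) :
    3 * (S.card * T.card * U.card) + 8 ≠ 8 * Fintype.card (ZMod 13 × ZMod 13) := by
  intro hV
  have hA : Fintype.card (ZMod 13 × ZMod 13) = 169 := by rw [Fintype.card_prod, ZMod.card]
  have hp : ∀ q : ZMod 13 × ZMod 13, 13 • q = 0 := by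
    intro q
    refine Prod.ext ?_ ?_
    · show 13 • q.1 = 0
      rw [nsmul_eq_mul, show ((13 : ℕ) : ZMod 13) = 0 from by decide, zero_mul]
    · show 13 • q.2 = 0
      rw [nsmul_eq_mul, show ((13 : ℕ) : ZMod 13) = 0 from by decide, zero_mul]
  have big : ¬ ∃ g : ZMod 13 × ZMod 13, Fintype.card (ZMod 13 × ZMod 13) ≤ 2 * addOrderOf g := by
    rintro ⟨g, hg⟩
    have hle : addOrderOf g ≤ 13 := Nat.le_of_dvd (by norm_num) (addOrderOf_dvd_of_nsmul_eq_zero (hp g))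
    rw [hA] at hg
    omega
  have hmod : Fintype.card (ZMod 13 × ZMod 13) % 3 = 1 := by rw [hA]
  have hA14 : 14 ≤ Fintype.card (ZMod 13 × ZMod 13) := by rw [hA]; norm_num
  have hA7 : 7 ≤ Fintype.card (ZMod 13 × ZMod 13) := by omega
  have hV_TUS : 3 * (T.card * U.card * S.card) + 8 = 8 * Fintype.card (ZMod 13 × ZMod 13) := by
    rw [show T.card * U.card * S.card = S.card * T.card * U.card by ring]; exact hV
  have hV_UST : 3 * (U.card * S.card * T.card) + 8 = 8 * Fintype.card (ZMod 13 × ZMod 13) := by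
    rw [show U.card * S.card * T.card = S.card * T.card * U.card by ring]; exact hV
  have hTUS : TripleProductProperty T U S := h.rotate
  have hUST : TripleProductProperty U S T := h.rotate.rotate
  by_cases hnc : ((univ.filter fun a : ZMod 13 × ZMod 13 => ρ a ∈ S).card = (univ.filter fun a : ZMod 13 × ZMod 13 => τ a ∈ S).card ∧
      (univ.filter fun a : ZMod 13 × ZMod 13 => ρ a ∈ T).card = (univ.filter fun a : ZMod 13 × ZMod 13 => τ a ∈ T).card ∧
      (univ.filter fun a : ZMod 13 × ZMod 13 => ρ a ∈ U).card = (univ.filter fun a : ZMod 13 × ZMod 13 => τ a ∈ U).card)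
  · obtain ⟨hS', hT', hU'⟩ := hnc
    have cS := card_eq_parts' hρ hτ hne hsurj S
    have cT := card_eq_parts' hρ hτ hne hsurj T
    have cU := card_eq_parts' hρ hτ hne hsurj U
    set s₀ := (univ.filter fun a : ZMod 13 × ZMod 13 => ρ a ∈ S).card with hs₀
    set t₀ := (univ.filter fun a : ZMod 13 × ZMod 13 => ρ a ∈ T).card with ht₀
    set u₀ := (univ.filter fun a : ZMod 13 × ZMod 13 => ρ a ∈ U).card with hu₀
    have eS : S.card = 2 * s₀ := by rw [cS, ← hS']; ring
    have eT : T.card = 2 * t₀ := by rw [cT, ← hT']; ring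
    have eU : U.card = 2 * u₀ := by rw [cU, ← hU']; ring
    have hprod : 3 * (s₀ * t₀ * u₀) + 1 = 169 := by
      rw [eS, eT, eU, hA] at hV; nlinarith
    rcases cube_factor_of_169 hprod with ⟨h1, h2, h3⟩ | ⟨h1, h2, h3⟩ | ⟨h1, h2, h3⟩ | ⟨h1, h2, h3⟩ | ⟨h1, h2, h3⟩ | ⟨h1, h2, h3⟩ | ⟨h1, h2, h3⟩ | ⟨h1, h2, h3⟩ | ⟨h1, h2, h3⟩ | ⟨h1, h2, h3⟩ | ⟨h1, h2, h3⟩ | ⟨h1, h2, h3⟩ | ⟨h1, h2, h3⟩ | ⟨h1, h2, h3⟩ | ⟨h1, h2, h3⟩ | ⟨h1, h2, h3⟩ | ⟨h1, h2, h3⟩ | ⟨h1, h2, h3⟩ | ⟨h1, h2, h3⟩ | ⟨h1, h2, h3⟩ | ⟨h1, h2, h3⟩ | ⟨h1, h2, h3⟩ | ⟨h1, h2, h3⟩ | ⟨h1, h2, h3⟩ | ⟨h1, h2, h3⟩ | ⟨h1, h2, h3⟩ | ⟨h1, h2, h3⟩ | ⟨h1, h2, h3⟩ | ⟨h1, h2,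 h3⟩ | ⟨h1, h2, h3⟩
    · -- (1,1,56)
      exact big (card_le_two_mul_addOrderOf_of_two_two_law hρρ hρτ hτρ hττ hρ hτ hne hsurj hmod hA7 h (by rw [eS, h1]) (by rw [eT, h2]) hV)
    · -- (1,2,28)
      exact big (card_le_two_mul_addOrderOf_of_mod_one_law_card_four hρρ hρτ hτρ hττ hρ hτ hne hsurj hmod hA14 h hV (by rw [eT, h2]))
    · -- (1,4,14)
      exact absurd hV (no_law_cube_two_parts_of_ordered 1 4 (fun h' hS₀ hS₁ hT₀ hT₁ hU'' hV'' => no_law_cube_14e_of_onto_z13z13 hρρ hρτ hτρ hττ hρ hτ hne hsurj (AddMonoidHom.id (ZMod 13 × ZMod 13)) Function.surjective_id h' hS₀ hS₁ hT₀ hT₁ hU'' hV'') h hS' hT' hU'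
        (Or.inl ⟨h1, h2⟩))
    · -- (1,7,8)
      exact absurd hV (no_law_cube_two_parts_of_ordered 1 7 (fun h' hS₀ hS₁ hT₀ hT₁ hU'' hV'' => no_law_cube_17e_of_onto_z13z13 hρρ hρτ hτρ hττ hρ hτ hne hsurj (AddMonoidHom.id (ZMod 13 × ZMod 13)) Function.surjective_id h' hS₀ hS₁ hT₀ hT₁ hU'' hV'') h hS' hT' hU'
        (Or.inl ⟨h1, h2⟩))
    · -- (1,8,7)
      exact absurd hV (no_law_cube_two_parts_of_ordered 1 7 (fun h' hS₀ hS₁ hT₀ hT₁ hU'' hV'' => no_law_cube_17e_of_onto_z13z13 hρρ hρτ hτρ hττ hρ hτ hne hsurj (AddMonoidHom.id (ZMod 13 × ZMod 13)) Function.surjective_id h' hS₀ hS₁ hT₀ hT₁ hU'' hV'') h hS' hT' hU'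
        (Or.inr (Or.inr (Or.inr (Or.inr (Or.inr (⟨h3, h1⟩)))))))
    · -- (1,14,4)
      exact absurd hV (no_law_cube_two_parts_of_ordered 1 4 (fun h' hS₀ hS₁ hT₀ hT₁ hU'' hV'' => no_law_cube_14e_of_onto_z13z13 hρρ hρτ hτρ hττ hρ hτ hne hsurj (AddMonoidHom.id (ZMod 13 × ZMod 13)) Function.surjective_id h' hS₀ hS₁ hT₀ hT₁ hU'' hV'') h hS' hT' hU'
        (Or.inr (Or.inr (Or.inr (Or.inr (Or.inr (⟨h3, h1⟩)))))))
    · -- (1,28,2)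
      exact big (card_le_two_mul_addOrderOf_of_mod_one_law_card_four hρρ hρτ hτρ hττ hρ hτ hne hsurj hmod hA14 hTUS hV_TUS (by rw [eU, h3]))
    · -- (1,56,1)
      exact big (card_le_two_mul_addOrderOf_of_two_two_law hρρ hρτ hτρ hττ hρ hτ hne hsurj hmod hA7 hUST (by rw [eU, h3]) (by rw [eS, h1]) hV_UST)
    · -- (2,1,28)
      exact big (card_le_two_mul_addOrderOf_of_mod_one_law_card_four hρρ hρτ hτρ hττ hρ hτ hne hsurj hmod hA14 hUST hV_UST (by rw [eS, h1]))
    · -- (2,2,14)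
      exact big (card_le_two_mul_addOrderOf_of_mod_one_law_card_four hρρ hρτ hτρ hττ hρ hτ hne hsurj hmod hA14 h hV (by rw [eT, h2]))
    · -- (2,4,7)
      exact big (card_le_two_mul_addOrderOf_of_mod_one_law_card_four hρρ hρτ hτρ hττ hρ hτ hne hsurj hmod hA14 hUST hV_UST (by rw [eS, h1]))
    · -- (2,7,4)
      exact big (card_le_two_mul_addOrderOf_of_mod_one_law_card_four hρρ hρτ hτρ hττ hρ hτ hne hsurj hmod hA14 hUST hV_UST (by rw [eS, h1]))
    · -- (2,14,2)
      exact big (card_le_two_mul_addOrderOf_of_mod_one_law_card_four hρρ hρτ hτρ hττ hρ hτ hne hsurj hmod hA14 hUST hV_UST (by rw [eS, h1]))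
    · -- (2,28,1)
      exact big (card_le_two_mul_addOrderOf_of_mod_one_law_card_four hρρ hρτ hτρ hττ hρ hτ hne hsurj hmod hA14 hUST hV_UST (by rw [eS, h1]))
    · -- (4,1,14)
      exact absurd hV (no_law_cube_two_parts_of_ordered 1 4 (fun h' hS₀ hS₁ hT₀ hT₁ hU'' hV'' => no_law_cube_14e_of_onto_z13z13 hρρ hρτ hτρ hττ hρ hτ hne hsurj (AddMonoidHom.id (ZMod 13 × ZMod 13)) Function.surjective_id h' hS₀ hS₁ hT₀ hT₁ hU'' hV'') h hS' hT' hU'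
        (Or.inr (Or.inr (Or.inr (Or.inl ⟨h1, h2⟩)))))
    · -- (4,2,7)
      exact big (card_le_two_mul_addOrderOf_of_mod_one_law_card_four hρρ hρτ hτρ hττ hρ hτ hne hsurj hmod hA14 h hV (by rw [eT, h2]))
    · -- (4,7,2)
      exact big (card_le_two_mul_addOrderOf_of_mod_one_law_card_four hρρ hρτ hτρ hττ hρ hτ hne hsurj hmod hA14 hTUS hV_TUS (by rw [eU, h3]))
    · -- (4,14,1)
      exact absurd hV (no_law_cube_two_parts_of_ordered 1 4 (fun h' hS₀ hS₁ hT₀ hT₁ hU'' hV'' => no_law_cube_14e_of_onto_z13z13 hρρ hρτ hτρ hττ hρ hτ hne hsurj (AddMonoidHom.id (ZMod 13 × ZMod 13)) Function.surjective_id h' hS₀ hS₁ hT₀ hT₁ hU'' hV'') h hS' hT' hU'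
        (Or.inr (Or.inr (Or.inl ⟨h3, h1⟩))))
    · -- (7,1,8)
      exact absurd hV (no_law_cube_two_parts_of_ordered 1 7 (fun h' hS₀ hS₁ hT₀ hT₁ hU'' hV'' => no_law_cube_17e_of_onto_z13z13 hρρ hρτ hτρ hττ hρ hτ hne hsurj (AddMonoidHom.id (ZMod 13 × ZMod 13)) Function.surjective_id h' hS₀ hS₁ hT₀ hT₁ hU'' hV'') h hS' hT' hU'
        (Or.inr (Or.inr (Or.inr (Or.inl ⟨h1, h2⟩)))))
    · -- (7,2,4)
      exact big (card_le_two_mul_addOrderOf_of_mod_one_law_card_four hρρ hρτ hτρ hττ hρ hτ hne hsurj hmod hA14 h hV (by rw [eT, h2]))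
    · -- (7,4,2)
      exact big (card_le_two_mul_addOrderOf_of_mod_one_law_card_four hρρ hρτ hτρ hττ hρ hτ hne hsurj hmod hA14 hTUS hV_TUS (by rw [eU, h3]))
    · -- (7,8,1)
      exact absurd hV (no_law_cube_two_parts_of_ordered 1 7 (fun h' hS₀ hS₁ hT₀ hT₁ hU'' hV'' => no_law_cube_17e_of_onto_z13z13 hρρ hρτ hτρ hττ hρ hτ hne hsurj (AddMonoidHom.id (ZMod 13 × ZMod 13)) Function.surjective_id h' hS₀ hS₁ hT₀ hT₁ hU'' hV'') h hS' hT' hU'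
        (Or.inr (Or.inr (Or.inl ⟨h3, h1⟩))))
    · -- (8,1,7)
      exact absurd hV (no_law_cube_two_parts_of_ordered 1 7 (fun h' hS₀ hS₁ hT₀ hT₁ hU'' hV'' => no_law_cube_17e_of_onto_z13z13 hρρ hρτ hτρ hττ hρ hτ hne hsurj (AddMonoidHom.id (ZMod 13 × ZMod 13)) Function.surjective_id h' hS₀ hS₁ hT₀ hT₁ hU'' hV'') h hS' hT' hU'
        (Or.inr (Or.inl ⟨h2, h3⟩)))
    · -- (8,7,1)
      exact absurd hV (no_law_cube_two_parts_of_ordered 1 7 (fun h' hS₀ hS₁ hT₀ hT₁ hU'' hV'' => no_law_cube_17e_of_onto_z13z13 hρρ hρτ hτρ hττ hρ hτ hne hsurj (AddMonoidHom.id (ZMod 13 × ZMod 13)) Function.surjective_id h' hS₀ hS₁ hT₀ hT₁ hU'' hV'') h hS' hT' hU'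
        (Or.inr (Or.inr (Or.inr (Or.inr (Or.inl ⟨h2, h3⟩))))))
    · -- (14,1,4)
      exact absurd hV (no_law_cube_two_parts_of_ordered 1 4 (fun h' hS₀ hS₁ hT₀ hT₁ hU'' hV'' => no_law_cube_14e_of_onto_z13z13 hρρ hρτ hτρ hττ hρ hτ hne hsurj (AddMonoidHom.id (ZMod 13 × ZMod 13)) Function.surjective_id h' hS₀ hS₁ hT₀ hT₁ hU'' hV'') h hS' hT' hU'
        (Or.inr (Or.inl ⟨h2, h3⟩)))
    · -- (14,2,2)
      exact big (card_le_two_mul_addOrderOf_of_mod_one_law_card_four hρρ hρτ hτρ hττ hρ hτ hne hsurj hmod hA14 h hV (by rw [eT, h2]))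
    · -- (14,4,1)
      exact absurd hV (no_law_cube_two_parts_of_ordered 1 4 (fun h' hS₀ hS₁ hT₀ hT₁ hU'' hV'' => no_law_cube_14e_of_onto_z13z13 hρρ hρτ hτρ hττ hρ hτ hne hsurj (AddMonoidHom.id (ZMod 13 × ZMod 13)) Function.surjective_id h' hS₀ hS₁ hT₀ hT₁ hU'' hV'') h hS' hT' hU'
        (Or.inr (Or.inr (Or.inr (Or.inr (Or.inl ⟨h2, h3⟩))))))
    · -- (28,1,2)
      exact big (card_le_two_mul_addOrderOf_of_mod_one_law_card_four hρρ hρτ hτρ hττ hρ hτ hne hsurj hmod hA14 hTUS hV_TUS (by rw [eU, h3]))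
    · -- (28,2,1)
      exact big (card_le_two_mul_addOrderOf_of_mod_one_law_card_four hρρ hρτ hτρ hττ hρ hτ hne hsurj hmod hA14 h hV (by rw [eT, h2]))
    · -- (56,1,1)
      exact big (card_le_two_mul_addOrderOf_of_two_two_law hρρ hρτ hτρ hττ hρ hτ hne hsurj hmod hA7 hTUS (by rw [eT, h2]) (by rw [eU, h3]) hV_TUS)
  · obtain ⟨g, a, b, hab⟩ :=
      two_cosets_of_mod_one_law_of_not_cube hρρ hρτ hτρ hττ hρ hτ hne hsurj hmod hA14 h hV hnc
    exact big ⟨g, card_le_two_mul_addOrderOf_of_two_cosets hab⟩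

end DihedralLike

end Summit.MatrixMultiplication.OmegaCensus
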